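import Literature.NumberTheory.EllipticCurves.BertoliniDarmon2005.AdmissiblePrimes
import HarnessLib

/-!
# Barrier (BirchSwinnertonDyer): no Bertolini–Darmon admissible primes at `p = 3` — the bipartite-Euler-system / admissible-level-raising architecture has an EMPTY supply of auxiliary primes at `p = 3` (and `p = 2`)

Barrier catalogue `Literature/Barriers/BirchSwinnertonDyer/` (D-0021), entry for the technique class
**bipartite Euler systems and Kolyvagin-system rigidity built from level raising at Bertolini–Darmon
`n`-admissible primes** (Bertolini–Darmon 2005; Howard 2006; W. Zhang 2014; Burungale–Castella–Kim 2021;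
Sweeting 2020), evaluated at the prime `p = 3`. Suggested by the W-ALL planner seat `bsd-wall-pss3` g2
(memo `run/shared/lean/pub/bsd-wall/bsd-wall-pss3/rev2/BARRIER-NOTE-NoAdmissiblePrimesAtThree.md`, answering
director-bsd 2026-08-27T08:26:43Z order (4): "name in one line the «p = 3 smallness» wall's exact hypothesis
… candidate Barriers note"); filed by cell `bsd-wall`, seat `bsd-wall-ty-1` g7. HONEST FRAMING: this is an
ARITHMETIC wall on the auxiliary-prime supply AS DEFINED IN PRINT — clause (3) "`p ∤ ℓ² − 1`" — and it is a
THEOREM (`noAdmissiblePrimesAtThree_holds`, one line over the tree's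
`BertoliniDarmon2005.not_isAdmissiblePrime_three`); it is NOT a statement that an anticyclotomic main
conjecture at `p = 3` fails or cannot be established (scope_caveats).

## The wall, as printed (every text held in the literature store; page = journal page unless "arXiv")

* Bertolini–Darmon, Ann. of Math. 162 (2005), p. 18: "A rational prime `ℓ` is said to be `n`-admissible
  relative to `f` if … (1) `ℓ` does not divide `N = pN⁺N⁻`; (2) `ℓ` is inert in `K/ℚ`; (3) `p` does not
  divide `ℓ² − 1`; (4) `pⁿ` divides `ℓ + 1 − a_ℓ` or `ℓ + 1 + a_ℓ`", used at once (p. 18, Lemma 2.6: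
  "`H¹_sing(K_ℓ, T_{f,n})` and `H¹_fin(K_ℓ, T_{f,n})` are both isomorphic to `ℤ/pⁿℤ` … in light of the fact
  that `p` does not divide `ℓ² − 1`"; p. 19 Remark 2: the difference from [BD0, Def. 2.20] is "that the
  local cohomology groups … are both free of rank one (and not two)"); p. 22 (proof of Thm. 3.2, the
  Čebotarev supply of `n`-admissible primes): "`λ ∈ (ℤ/pⁿℤ)^×` is not equal to `±1` mod `p` … (Note that
  here the assumption that `p > 3` is needed.)"; standing Assumption 6 (1) p. 4: "The prime `p` is `≥ 5`."
  Tree: `Literature.NumberTheory.EllipticCurves.BertoliniDarmon2005.IsAdmissiblePrime N K a p n ℓ`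
  (`Literature/NumberTheory/EllipticCurves/BertoliniDarmon2005/AdmissiblePrimes.lean`, with the vacuity
  theorems `not_isAdmissiblePrime_three`, `not_isAdmissiblePrime_two`, `three_lt_of_isAdmissiblePrime`).
* Howard, J. reine angew. Math. 597 (2006), Def. 3.1.1: "A degree two prime `𝔩 ∤ N` of `K` is
  `k`-admissible if `N(𝔩) ≢ 1 (mod p)`, and if there is a decomposition `E[p^k] ≅ ℤ/p^kℤ ⊕ μ_{p^k}` of
  `Gal(K_𝔩^unr/K_𝔩)`-modules" — `N(𝔩) = ℓ²` for the inert `ℓ` below `𝔩`; standing hypothesis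
  (Introduction): "a rational prime `p ∤ 6 d_K N` at which `E` has good ordinary reduction".
* W. Zhang, Camb. J. Math. 2 (2014), p. 202 Notations (xiv): "a prime `q` is called admissible if `q` is
  prime to `NDp`, inert in `K`, `p` does not divide `q² − 1`, and the index `v_p((q+1)² − a_q²) ≥ 1`";
  p. 203 Thm. 2.1 (Ribet, Diamond–Taylor level raising, "residue characteristic `p ≥ 5` … for each
  admissible prime `q`"); p. 232 Lemma 7.3 "Assume `p ≥ 5`. … there exists a positive density of admissible
  primes `q` such that the localization `loc_q(c)` is nonzero"; p. 193: "Throughout this paper we assume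
  that `ρ̄_{E,p}` is surjective, `p ∤ N`, and `p ≥ 5`."
* Burungale–Castella–Kim, Algebra Number Theory 15 (2021) (arXiv:1908.09512), §1.1: "Let `p > 3` be a
  prime of good ordinary reduction"; bipartite section (arXiv p. 12): "We say that a prime `q` is admissible
  (following [BD05]) if `q` is inert in `K`, prime to `ND_Kp`, does not divide `q² − 1`, and the index
  `M′(q) := v_𝔭((q+1)² − a_q²)` is strictly positive."
* Sweeting, arXiv:2012.11771, §1 (how the hypotheses intervene): "We use `p ≥ 5` to ensure that there are
  primes `q ≢ ±1 (mod p)` as well as to apply [Helm, Ramakrishna, Camporino]"; Def. 3.1: "`M`-Taylor-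
  admissible … If additionally `p ∤ (q² − 1)`, then `q` is called `M`-BD-admissible"; Thm. 3.3 (level
  raising at a Taylor-admissible prime): "Suppose `p ≥ 5`"; §3: "this argument relies on Ihara's Lemma for
  Shimura curves [DT94], which uses `p ≥ 5`"; §4: "Any `M`-BD-admissible prime is from now on assumed to be
  inert in `K` as well" — the Kolyvagin classes `c_M(n, Q)` are built on BD-admissible `Q`.
* A DISPLAYED-HYPOTHESIS TRAP (read first-hand after the tribunal T2 seat's note of 2026-08-27T10:26:38Z):
  Castella–Hsu–Kundu–Lee–Liu, arXiv:2308.10474 (PREPRINT, 2023), §7.1 p. 29: "let `p > 2` be a prime of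
  good supersingular reduction for `E`. We assume that (non-ord) `a_p(E) = 0` (which by the Hasse bounds is
  automatic for `p > 3`)", Thm. 7.1 / Cor. 7.2 (the `±`-Heegner-point anticyclotomic main conjecture of
  [CW24, Conj. 4.8] under (i) `N` square-free, (ii)–(iv)) — the displayed hypotheses ADMIT `p = 3`; but
  the proof is a bipartite Euler system over BD `j`-admissible primes: §7.2 p. 30 "We refer the reader to
  [BD05, p. 18] for the definition of `j`-admissible primes … Remark 7.3. By definition, admissible primes
  `q ∈ 𝓛` satisfy in particular `q ≢ ±1 (mod p)`" (level raising via [Zha14, Thm. 2.1]), and §7.4 p. 33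
  needs "`m = q₁ ⋯ q_{2s} q_r`", a square-free product of an ODD number of admissible primes (at least
  one) — so at `p = 3` the proof instantiates an empty set and the printed theorem must be read `p ≥ 5`.

So every refereed member of the class quantifies over primes `ℓ` with `p ∤ ℓ² − 1` (equivalently
`ℓ ≢ ±1 (mod p)`, `BertoliniDarmon2005.int_dvd_sq_sub_one_iff`). At `p = 3` there is NO such prime:
`ℓ = 3` violates (1), and `ℓ² ≡ 1 (mod 3)` for every prime `ℓ ≠ 3` (`𝔽₃^× = {±1}`). The supply is empty —
not merely unproved — so no theorem of the class can be INSTANTIATED at `p = 3` as printed, whatever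
`N`, `K`, `a`, `n`.

## What survives at `p = 3` (so the wall is NOT "everything anticyclotomic assumes `p > 3`")

* The ⊆ half by KOLYVAGIN primes (`pⁿ ∣ ℓ + 1` AND `pⁿ ∣ a_ℓ`, the rank-two cousins of BD's Remark 1
  p. 19 — they have `ℓ ≡ −1 (mod p)` by design): Howard's Heegner-point Kolyvagin system is printed for
  `p` odd under a full `p`-adic image hypothesis over `K` (tree `Literature/NumberTheory/EllipticCurves/
  HeegnerPointsKolyvaginEulerSystem.lean`, `IsKolyvaginPrime`).
* The ⊇ half at `p = 3` by a DIFFERENT technique (Wan's `U(3,1)` Rankin–Selberg divisibility): Jetchev–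
  Skinner–Wan, Camb. J. Math. 5 (2017), Thm. 1.2.1, `p = 3` clause "provided `a_p(E) = 0` when `E` has
  supersingular reduction at `p`", for square-free `N` with `3 ∤ N` (tree binder `hJSW` of W-ALL).
* The BDP `p`-adic `L`-function and `p`-adic Waldspurger formula at an odd split `p ∤ N` (Castella–Hsieh
  2018, "Fix an odd prime `p ∤ N`") — in print at `p = 3`.

## D-0021 structured block
The six key lines of this entry are carried by the docstring of the declaration `NoAdmissiblePrimesAtThree`
below (the gate's barrier catalogue parses DECLARATION docstrings).

## References (bib keys of `lean/references.bib`)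
[BertoliniDarmon2005] p. 4 Ass. 6 (1), p. 18 (Admissible primes, Lemma 2.6), p. 19 Remarks 1–2, p. 22
(proof of Thm. 3.2) · [Howard2006] Introduction, Def. 3.1.1 · [WZhang2014] pp. 193, 202 (xiv), 203 Thm. 2.1,
232 Lemma 7.3 · [BurungaleCastellaKim2021] §1.1, bipartite section (admissible primes) · [Sweeting2020] §1,
Def. 3.1, Thm. 3.3, §4 · [Nekovar2012] Thm. A, Prop. 2.3.3 · [JetchevSkinnerWan2017] Thm. 1.2.1 ·
[CastellaHsieh2018] §1 · [DiamondTaylor1994] · [CastellaEtAl2023] §7.1 p. 29 (Thm. 7.1, Cor. 7.2), §7.2 p. 30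
(Remark 7.3), §7.4 p. 33 (the displayed-hypothesis trap). Cell documents: `run/shared/lean/pub/bsd-wall/bsd-wall-pss3/
rev2/BARRIER-NOTE-NoAdmissiblePrimesAtThree.md` (page-verified evidence list), `…/rev2/barriers.txt`
(placement on route `UniversalToricDescent`).
-/

namespace Literature.Barriers.BirchSwinnertonDyer

open Literature.NumberTheory.EllipticCurves.BertoliniDarmon2005

universe u

/-- The technique class of this entry, as a predicate on the data `(N, K, a, p, n)` of a weight-two
eigenform `f` (level `N`, Hecke eigenvalues `a`), an imaginary quadratic field `K`, a prime `p` and an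
exponent `n`: the MINIMAL INPUT every bipartite-Euler-system / admissible-level-raising argument consumes —
the existence of at least one Bertolini–Darmon `n`-admissible prime `ℓ` (printed arguments need infinitely
many, BD05 Thm. 3.2 / W. Zhang 2014 Lemma 7.3; one is the weakest form). The admissibility predicate is the
tree's `BertoliniDarmon2005.IsAdmissiblePrime` (cited, not restated).
[cite: BertoliniDarmon2005, p. 18 (Admissible primes) and Thm. 3.2] [cite: WZhang2014, p. 202 (xiv) and Lemma 7.3 (p. 232)] -/
def HasAdmissiblePrime (N : ℕ) (K : Type u) [Field K] (a : ℕ → ℤ) (p n : ℕ) : Prop :=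
  ∃ ℓ : ℕ, IsAdmissiblePrime N K a p n ℓ

/-- Unfolding of `HasAdmissiblePrime`. [cite: BertoliniDarmon2005, p. 18 (Admissible primes)] -/
theorem hasAdmissiblePrime_iff (N : ℕ) (K : Type u) [Field K] (a : ℕ → ℤ) (p n : ℕ) :
    HasAdmissiblePrime N K a p n ↔ ∃ ℓ : ℕ, IsAdmissiblePrime N K a p n ℓ :=
  Iff.rfl

/-- **The barrier**: at `p = 3` the technique class has NO admissible prime — for every level `N`, every
field `K`, every coefficient system `a` and every exponent `n`, `¬ HasAdmissiblePrime N K a 3 n`. PROVED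
below (`noAdmissiblePrimesAtThree_holds`); the closed `Prop` is the decl that idea cards and route theses
cite.

BARRIER (D-0021), one line per key:
* technique_class: bipartite-euler-systems level-raising-at-admissible-primes kolyvagin-system-rigidity anticyclotomic-iwasawa — formally `HasAdmissiblePrime N K a p n` (∃ a Bertolini–Darmon `n`-admissible prime, tree `BertoliniDarmon2005.IsAdmissiblePrime`: `ℓ` prime, `ℓ ∤ pN`, `ℓ𝓞_K` prime, `p ∤ ℓ² − 1`, `pⁿ ∣ ℓ + 1 ∓ a_ℓ`) evaluated at `p = 3`; the same clause `p ∤ ℓ² − 1` / `N(𝔩) ≢ 1 (mod p)` is printed in every member of the class [cite: BertoliniDarmon2005, p. 18 (Admissible primes) (3)] [cite: Howard2006, Def. 3.1.1] [cite: WZhang2014, p. 202 (xiv)] [cite: BurungaleCastellaKim2021, bipartite Euler system section (admissible primes "following [BD05]")] [cite: Sweeting2020, Def. 3.1 (M-BD-admissible)]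
* blocks: at `p = 3` (any `E/ℚ`, any `K`, any level — scope is the prime alone) every INSTANTIATION of a theorem of the class as printed, and every transfer of its METHOD: the ⊇ half ("indivisibility" / lower bound) of anticyclotomic Iwasawa main identities (IMC) and of Kolyvagin's non-triviality statement `κ^∞ ≠ 0` (W. Zhang 2014 Thm. 1.1) obtained from level raising at admissible primes [cite: BertoliniDarmon2005, Thm. 1 with Assumption 6 (1) "p ≥ 5"] [cite: WZhang2014, Thm. 2.1 and Lemma 7.3 (p ≥ 5)] [cite: BurungaleCastellaKim2021, §1.1 (p > 3)] [cite: Sweeting2020, §1 ("We use p ≥ 5 to ensure that there are primes q ≢ ±1 (mod p)")]; in the W-ALL cell (rung «BSD for every rank ≤ 1 curve over ℚ», `Summit.BirchSwinnertonDyer.WAll`) this is the located wall of route `route-BirchSwinnertonDyer-UniversalToricDescent` (leaf `WAllExclAddWildRankOne`, wild additive `3`, rank one): crux `TwinSplitIMCAtThree` (⊇ half of the split anticyclotomic IMC at `3` for a semistable-at-`3` twin `E′` outside Jetchev–Skinner–Wan's `p = 3` clause, i.e. `3 ∥ N′` or `N′` not square-free) has no printed bipartite input, and crux `ToricTransportModThree`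 is hit through the printed classes its universal element specialises to (cell memo `bsd-wall-pss3/rev2/barriers.txt`); likewise every W-ALL item at `p = 3` on rows 3 (X11b, multiplicative `3`, `r = 1` — the class for which the tree's `AdmissiblePrimes.lean` was typed, cell `b2b-bsdres` team x11b3) and 4/5 (Eisenstein `3`) that would import Bertolini–Darmon 2005, W. Zhang 2014, Burungale–Castella–Kim 2021 or Sweeting 2020 at `p = 3`; and — the trap — printed statements whose DISPLAYED hypotheses admit `p = 3` but whose PROOFS instantiate admissible primes are inside the wall at `3` and must be read `p ≥ 5`: Castella–Hsu–Kundu–Lee–Liu 2023 Thm. 7.1 / Cor. 7.2 (the `±`-Heegner-point anticyclotomic IMC of Castella–Wan at a good SUPERSINGULAR `p > 2`, `a_p = 0`, `p` split in `K`, `N` square-free) is proved in §7.4 by level raising at a square-free product `m = q₁ ⋯ q_{2s} q_r` of an odd number of BD `j`-admissible primes (Remark 7.3: "`q ≢ ±1 (mod p)`"), empty at `3` — which is exactly where a good-supersingular-at-`3` twin of the W-ALL wild cell would want it [cite: CastellaEtAl2023, §7.1 Thm. 7.1 and Cor. 7.2 (p > 2 displayed), §7.2 Remark 7.3, §7.4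 (m = q₁⋯q_{2s}q_r)]
* because: clause (3) `p ∤ ℓ² − 1` is what makes the local cohomology at an admissible `ℓ` free of rank ONE — "`H¹_sing(K_ℓ, T_{f,n})` and `H¹_fin(K_ℓ, T_{f,n})` are both isomorphic to `ℤ/pⁿℤ` … in light of the fact that `p` does not divide `ℓ² − 1`" [cite: BertoliniDarmon2005, p. 18 Lemma 2.6 and p. 19 Remark 2] — and the Čebotarev supply needs an element "`λ ∈ (ℤ/pⁿℤ)^×` … not equal to `±1` mod `p` … (Note that here the assumption that `p > 3` is needed.)" [cite: BertoliniDarmon2005, p. 22 (proof of Thm. 3.2)]; at `p = 3`, `(ℤ/3ℤ)^× = {±1}`: `ℓ = 3` violates clause (1) `ℓ ∤ pN` and every prime `ℓ ≠ 3` has `ℓ² ≡ 1 (mod 3)` (tree `BertoliniDarmon2005.three_dvd_sq_sub_one`, `not_isAdmissiblePrime_three`), so the set of admissible primes is EMPTY (`BertoliniDarmon2005.setOf_isAdmissiblePrime_three_eq_empty`) — which is all the Lean proof uses; the level-raising step is printed for residue characteristic `p ≥ 5` as well (Diamond–Taylor / Ihara's lemma for Shimura curves) [cite: WZhang2014, Thm.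 2.1 (p ≥ 5)] [cite: Sweeting2020, Thm. 3.3 and §3 ("Ihara's Lemma for Shimura curves [DT94], which uses p ≥ 5")] [cite: DiamondTaylor1994, Thm. 2]
* evasions_known: (i) KOLYVAGIN primes instead of admissible primes (`pⁿ ∣ ℓ + 1` and `pⁿ ∣ a_ℓ`, so `ℓ ≡ −1 (mod p)` by design; local conditions free of rank two) — the Heegner-point Kolyvagin / Euler system gives the ⊆ half (upper bound on Selmer) at odd `p` including `3` under a full `p`-adic image hypothesis over `K`, not the ⊇ half [cite: BertoliniDarmon2005, p. 19 Remark 1 ("the n-admissible primes are not the primes appearing in Kolyvagin's study … where the condition that pⁿ divides ℓ + 1 was imposed")]; (ii) a DIFFERENT road to the ⊇ half at `p = 3`: Wan's `U(3,1)` Rankin–Selberg divisibility as used by Jetchev–Skinner–Wan, printed at `p = 3` for square-free `N`, `3 ∤ N`, with `a_3 = 0` if supersingular [cite: JetchevSkinnerWan2017, Thm. 1.2.1 (p = 3 clause)]; (iii) BOUNDED-ERROR level raising: Nekovář allows `ord_p(N(ℓ)² − 1) = ord_p(u_g² − 1) = C₂ < ∞` instead of `= 0` and obtains FINITENESS / vanishing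 of Selmer groups (`H¹_f(K, V ⊗ χ) = 0` when `L(f_K, χ, 1) ≠ 0`, integrally outside a finite set of `p`), not the exact indivisibility / equality of characteristic ideals the ⊇ half needs [cite: Nekovar2012, Prop. 2.3.3 (p. 620) and Thm. A (p. 592)]; (iv) Taylor-admissible primes (no `q² − 1` clause) raise the level mod `𝔭^M` but the Kolyvagin classes of the patched system are still built on BD-admissible sets, and the level-raising theorem itself is printed for `p ≥ 5` [cite: Sweeting2020, Def. 3.1, Remark 3.2, Thm. 3.3, §4]
* scope_caveats: (a) the theorem is about the auxiliary primes AS DEFINED IN PRINT (clause (3)); it does not say that the ⊇ half of an anticyclotomic IMC, Kolyvagin's non-triviality statement, or `BSD_3` fails or cannot be established at `p = 3` — only that no printed theorem of THIS class can be instantiated there and that a transfer must replace clause (3) (e.g. by rank-two local conditions as in Bertolini–Darmon 1994 [BD0, Def. 2.20], whose compatibility with the bipartite rigidity argument is NOT in print) [cite: BertoliniDarmon2005, p. 19 Remark 2]; (b) the same arithmetic empties the class at `p = 2` (`not_hasAdmissiblePrime_two`), and at every prime `p ≥ 5` clause (3) alone is satisfiable (`ℓ = 2`: `p ∤ 3`,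 `not_dvd_two_sq_sub_one`) — the actual positive-density supply there is BD05 Thm. 3.2 / W. Zhang Lemma 7.3 (Čebotarev), NOT recorded in the tree; (c) `K` is any field in the Lean statement (intended: imaginary quadratic); clause (2) is rendered "`ℓ𝓞_K` is a prime ideal" as in the tree's definition; (d) other `p = 3` obstacles of the neighbouring literature (full `3`-adic image over `K` for Howard's Kolyvagin system — mod-`3` surjectivity does not imply `3`-adic surjectivity; `p ∤ 6` in Howard 2006; Ihara/Diamond–Taylor at `p ≥ 5`) are separate hypotheses, cited above but not formalised here; (e) the entry is indexed by the METHOD, not by the displayed hypotheses of a statement: whether a given printed theorem is inside the wall at `p = 3` is decided by reading its PROOF for admissible primes (the CHKLL 2023 Thm. 7.1 example of `blocks:`; found by the tribunal T2 seat bsd-trib-t2-1, 2026-08-27), and the list of such traps is not claimed complete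
* status: established (theorem `noAdmissiblePrimesAtThree_holds`, over `BertoliniDarmon2005.not_isAdmissiblePrime_three`; the printed remark "here the assumption that p > 3 is needed" [cite: BertoliniDarmon2005, p. 22]; literature list read at the page by seats bsd-wall-pss3 g2 (memo) and bsd-wall-ty-1 g7 (this file), 2026-08-27; W. Zhang 2014 / BD05 locators re-read letter-true by bsd-cited-r16, rider D-AUDIT-r16-S7; amended the same day by bsd-wall-ty-1 g7 with the CHKLL 2023 clause of `blocks:` / caveat (e) — no Lean statement changed)

[cite: BertoliniDarmon2005, p. 18 (Admissible primes) (3) and p. 22 (proof of Thm. 3.2)]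
[cite: WZhang2014, p. 202 (xiv) and Lemma 7.3] [cite: Howard2006, Def. 3.1.1] -/
def NoAdmissiblePrimesAtThree : Prop :=
  ∀ (N : ℕ) (K : Type u) [Field K] (a : ℕ → ℤ) (n : ℕ), ¬ HasAdmissiblePrime N K a 3 n

/-- The barrier holds: a `3`-admissible prime would be a prime `ℓ` with `ℓ ∤ 3N` and `3 ∤ ℓ² − 1`, and
there is none (`BertoliniDarmon2005.not_isAdmissiblePrime_three`).
[cite: BertoliniDarmon2005, p. 22 (proof of Thm. 3.2: "here the assumption that p > 3 is needed")] -/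
theorem noAdmissiblePrimesAtThree_holds : NoAdmissiblePrimesAtThree.{u} := by
  intro N K _ a n h
  obtain ⟨ℓ, hℓ⟩ := h
  exact not_isAdmissiblePrime_three ℓ hℓ

/-- Pointwise form of the barrier. [cite: BertoliniDarmon2005, p. 22 (proof of Thm. 3.2)] -/
theorem not_hasAdmissiblePrime_three (N : ℕ) (K : Type u) [Field K] (a : ℕ → ℤ) (n : ℕ) :
    ¬ HasAdmissiblePrime N K a 3 n :=
  noAdmissiblePrimesAtThree_holds N K a n

/-- The other half of the printed "`p > 3` is needed": the class is empty at `p = 2` as well (an odd prime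
has `ℓ² ≡ 1 (mod 2)`; `ℓ = 2` violates clause (1)). [cite: BertoliniDarmon2005, p. 22 (proof of Thm. 3.2)] -/
theorem not_hasAdmissiblePrime_two (N : ℕ) (K : Type u) [Field K] (a : ℕ → ℤ) (n : ℕ) :
    ¬ HasAdmissiblePrime N K a 2 n := by
  rintro ⟨ℓ, hℓ⟩
  exact not_isAdmissiblePrime_two ℓ hℓ

/-- Contrapositive, the form a planner's crux consumes: if the technique class has ANY admissible prime for
`(N, K, a, p, n)` with `p` prime, then `3 < p`. [cite: BertoliniDarmon2005, p. 22 (proof of Thm. 3.2)] -/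
theorem three_lt_of_hasAdmissiblePrime {N : ℕ} {K : Type u} [Field K] {a : ℕ → ℤ} {p n : ℕ}
    (hp : p.Prime) (h : HasAdmissiblePrime N K a p n) : 3 < p := by
  obtain ⟨ℓ, hℓ⟩ := h
  exact three_lt_of_isAdmissiblePrime hp hℓ

/-- The printed form of the scope, "`p ≥ 5`" (BD05 Assumption 6 (1), W. Zhang 2014 Lemma 7.3, Sweeting
2020 §1): a prime `p` for which some admissible prime exists satisfies `5 ≤ p`.
[cite: BertoliniDarmon2005, p. 4 Assumption 6 (1)] [cite: WZhang2014, Lemma 7.3 (p. 232)] -/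
theorem five_le_of_hasAdmissiblePrime {N : ℕ} {K : Type u} [Field K] {a : ℕ → ℤ} {p n : ℕ}
    (hp : p.Prime) (h : HasAdmissiblePrime N K a p n) : 5 ≤ p := by
  have h3 : 3 < p := three_lt_of_hasAdmissiblePrime hp h
  by_contra h5
  have h4 : p = 4 := by omega
  exact (by decide : ¬ (4 : ℕ).Prime) (h4 ▸ hp)

/-! ## Howard's norm form and the sharpness of clause (3) -/

/-- Howard's clause "`N(𝔩) ≢ 1 (mod p)`" (Def. 3.1.1) fails at `p = 3` for the same reason: for a prime
`ℓ ≠ 3` — the rational prime under a degree-two prime `𝔩` of `K`, `N(𝔩) = ℓ²` — one has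
`ℓ² ≡ 1 (mod 3)`. [cite: Howard2006, Def. 3.1.1] [cite: BertoliniDarmon2005, p. 22 (proof of Thm. 3.2)] -/
theorem sq_modEq_one_three {ℓ : ℕ} (hℓ : ℓ.Prime) (h3 : ℓ ≠ 3) : ℓ ^ 2 ≡ 1 [MOD 3] := by
  have h : (3 : ℤ) ∣ (ℓ : ℤ) ^ 2 - 1 := three_dvd_sq_sub_one hℓ h3
  have h' : ((1 : ℕ) : ℤ) ≡ ((ℓ ^ 2 : ℕ) : ℤ) [ZMOD ((3 : ℕ) : ℤ)] := by
    rw [Int.modEq_iff_dvd]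
    simpa using h
  exact (Int.natCast_modEq_iff.mp h').symm

/-- Sharpness of clause (3): at every prime `p` other than `3` — in particular at every `p ≥ 5` — the
clause `p ∤ ℓ² − 1` IS satisfiable, by `ℓ = 2` (`2² − 1 = 3`); so the emptiness recorded by
`NoAdmissiblePrimesAtThree` is exactly a small-prime phenomenon of clause (3) (at `p = 2` it is clause (1)
that removes `ℓ = 2`). The positive-density supply at `p ≥ 5` is BD05 Thm. 3.2 (not recorded in the tree).
[cite: BertoliniDarmon2005, p. 18 (Admissible primes) (3) and Thm. 3.2] -/
theorem not_dvd_two_sq_sub_one {p : ℕ} (hp : p.Prime) (h3 : p ≠ 3) : ¬ ((p : ℤ) ∣ (2 : ℤ) ^ 2 - 1) := by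
  intro h
  have h' : (p : ℤ) ∣ (3 : ℕ) := by simpa using h
  have hp3 : p ∣ 3 := by exact_mod_cast h'
  exact h3 ((Nat.prime_dvd_prime_iff_eq hp Nat.prime_three).mp hp3)

end Literature.Barriers.BirchSwinnertonDyer
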